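import Summits.Langlands.Langlands.Theses.WeightMultiplicitySplit

/-!
# Glue of the layer-2 SPLIT of `WallWeightReciprocity` (route WeightMultiplicitySplit) — target
`Summits/Langlands/Langlands/Theorems/WeightMultiplicitySplitWallWeightReciprocityOfSplit.lean`

Closes the gate-generated glue item (children → parent, no outside hypothesis)
`WallWeightReciprocity_of_split : WallAutomorphicToGalois → WallArtinTypeAutomorphy → WallStructuredAutomorphy → WallLieIrreducibleAutomorphy → GenericRankStep → WallWeightReciprocity`
of `ledger route edit route-Langlands-WeightMultiplicitySplit --split WallWeightReciprocity --into children_W.json --k-override 5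
--glue-decl-name WallWeightReciprocity_of_split` (lens-2-g10 node `IrregularLieTypeSplit`, decomp-langlands, 2026-08-30).  The fifth child
`GenericRankStep` is the FEED piece (= the route's crux `GenericWeightReciprocity` 24355 in IH form; it closes from 24355 by the one-liner staged in
`kit_check.lean`).  To be proposed AFTER the split lands (`--supports <new glue item>`), exactly as `RootDecomp1CuspidalAvatarIrreducibleOfSplit.lean`
closed stmt-Langlands-31316: DELETE the block
between the `-- MOCK BEGIN` / `-- MOCK END` markers and replace the prefix `WeightMultiplicitySplit.` by `WeightMultiplicitySplit.` in the
theorem statement.  Certified beforehand against the mock below AND against a verbatim copy of the route file of record (rev 0) extended exactly as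
the gate renders the two splits (`kit_check.lean`: rc 0 · 0 sorry · axioms propext / Classical.choice / Quot.sound).
PURE LOGIC: ONE strong induction on the rank `n` (the five children carry the inlined induction hypothesis «multiplicity-≤-2 reciprocity at every
rank m < n over every number field and datum»), then excluded middle on the INLINED chamber condition (multiplicity ≤ 1 → the feed `GenericRankStep`)
and on the dials «ρ potentially scalar?» (→ Artin-type cell), else «ρ Lie-irreducible?» (→ Lie-irreducible cell / structured cell).  No new
mathematics, 0 EQUIV, no definitions.
-/

set_option linter.dupNamespace false -- project-wide option; `Summit.Langlands.Langlands` is the mandated namespace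


namespace Summit.Langlands.Langlands.Theorems

open scoped Classical
open Summit.Langlands.Langlands.Theses

/-- The glue item of the lens-2-g10 split of `WeightMultiplicitySplit.WallWeightReciprocity` (stmt-Langlands-24354): the five children
`WallAutomorphicToGalois` ((A)-clause + non-vacuity), `WallArtinTypeAutomorphy` ((B), ρ potentially scalar), `WallStructuredAutomorphy` ((B), ρ neither
potentially scalar nor Lie-irreducible), `WallLieIrreducibleAutomorphy` ((B), ρ Lie-irreducible, not potentially scalar) and the feed `GenericRankStep`
(generic reciprocity at the rank) — each stated GIVEN multiplicity-≤-2 reciprocity below the rank — imply the parent, by strong induction on the rank and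
cases on the inlined dials. -/
theorem WeightMultiplicitySplit_WallWeightReciprocity_of_split_proof :
    Summit.Langlands.Langlands.Theses.WeightMultiplicitySplit.WallWeightReciprocity_of_split := by
  intro hA hF hS hP hGb
  have key : ∀ (n : ℕ) (F : Type) [Field F] [NumberField F] (Rd : Summit.Langlands.ReciprocityData F), 0 < n →
      ∀ hcpt : Literature.NumberTheory.Automorphic.isCompact_glFiniteIntegralLevel n F, (∀ π : Literature.NumberTheory.Automorphic.CuspidalAutomorphicRepData n F hcpt, π.1.IsLAlgebraic → (∃ T : Literature.NumberTheory.Automorphic.InfinityType F n, π.1.HasInfinityType T ∧ ∀ (σ : F →+* ℂ) (a : ℂ), ((T σ).map Literature.NumberTheory.Automorphic.ArchWeight.a).count a ≤ 2) → ∀ (ℓ : ℕ) [Fact ℓ.Prime] (ι : PadicAlgCl ℓ ≃+* ℂ), ∃ ρ : Literature.NumberTheory.GaloisRepresentations.FramedGaloisRep F (PadicAlgCl ℓ) n, ρ.toGaloisRep.IsIrreducible ∧ Summit.Langlands.IsGeometricFramed Rd ρ ∧ Summit.Langlands.Corresponds Rd ι π.1 ρ ∧ ∀ ρ' : Literature.NumberTheory.GaloisRepresentations.FramedGaloisRep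 F (PadicAlgCl ℓ) n, Summit.Langlands.Corresponds Rd ι π.1 ρ' → Summit.Langlands.IsConjugate ρ ρ') ∧ (∀ (ℓ : ℕ) [Fact ℓ.Prime] (ι : PadicAlgCl ℓ ≃+* ℂ) (ρ : Literature.NumberTheory.GaloisRepresentations.FramedGaloisRep F (PadicAlgCl ℓ) n), ρ.toGaloisRep.IsIrreducible → Summit.Langlands.IsGeometricFramed Rd ρ → (∀ (v : IsDedekindDomain.HeightOneSpectrum (NumberField.RingOfIntegers F)) (hv : ((ℓ : ℕ) : NumberField.RingOfIntegers F) ∈ v.asIdeal) (τ : v.adicCompletion F →+* PadicAlgCl ℓ), Continuous τ → ∀ w : ℤ, (ρ.labelledHodgeTateWeightsAt v (Literature.NumberTheory.PAdicHodge.fontainePstAdicCompletion v ℓ hv).algebra (Literature.NumberTheory.PAdicHodge.fontainePstAdicCompletion v ℓ hv).𝔅 τ).count w ≤ 2) → ∃ π : Literature.NumberTheory.Automorphic.CuspidalAutomorphicRepData n F hcpt, π.1.IsLAlgebraic ∧ Summit.Langlands.Corresponds Rd ι π.1 ρ) := by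
    intro n
    induction n using Nat.strong_induction_on with
    | _ n ih =>
      intro F _ _ Rd hn hcpt
      have hIH : (∀ (m : ℕ), m < n → 0 < m → ∀ (L : Type) [Field L] [NumberField L] (RdL : Summit.Langlands.ReciprocityData L) (hcptL : Literature.NumberTheory.Automorphic.isCompact_glFiniteIntegralLevel m L), (∀ π : Literature.NumberTheory.Automorphic.CuspidalAutomorphicRepData m L hcptL, π.1.IsLAlgebraic → (∃ T : Literature.NumberTheory.Automorphic.InfinityType L m, π.1.HasInfinityType T ∧ ∀ (σ : L →+* ℂ) (a : ℂ), ((T σ).map Literature.NumberTheory.Automorphic.ArchWeight.a).count a ≤ 2) → ∀ (ℓ : ℕ) [Fact ℓ.Prime] (ι : PadicAlgCl ℓ ≃+* ℂ), ∃ ρ : Literature.NumberTheory.GaloisRepresentations.FramedGaloisRep L (PadicAlgCl ℓ) m, ρ.toGaloisRep.IsIrreducible ∧ Summit.Langlands.IsGeometricFramed RdL ρ ∧ Summit.Langlands.Corresponds RdL ι π.1 ρ ∧ ∀ ρ' : Literature.NumberTheory.GaloisRepresentations.FramedGaloisRep L (PadicAlgCl ℓ) m, Summit.Langlands.Corresponds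 RdL ι π.1 ρ' → Summit.Langlands.IsConjugate ρ ρ') ∧ (∀ (ℓ : ℕ) [Fact ℓ.Prime] (ι : PadicAlgCl ℓ ≃+* ℂ) (ρ : Literature.NumberTheory.GaloisRepresentations.FramedGaloisRep L (PadicAlgCl ℓ) m), ρ.toGaloisRep.IsIrreducible → Summit.Langlands.IsGeometricFramed RdL ρ → (∀ (v : IsDedekindDomain.HeightOneSpectrum (NumberField.RingOfIntegers L)) (hv : ((ℓ : ℕ) : NumberField.RingOfIntegers L) ∈ v.asIdeal) (τ : v.adicCompletion L →+* PadicAlgCl ℓ), Continuous τ → ∀ w : ℤ, (ρ.labelledHodgeTateWeightsAt v (Literature.NumberTheory.PAdicHodge.fontainePstAdicCompletion v ℓ hv).algebra (Literature.NumberTheory.PAdicHodge.fontainePstAdicCompletion v ℓ hv).𝔅 τ).count w ≤ 2) → ∃ π : Literature.NumberTheory.Automorphic.CuspidalAutomorphicRepData m L hcptL, π.1.IsLAlgebraic ∧ Summit.Langlands.Corresponds RdL ι π.1 ρ)) := fun m hm hm0 L _ _ RdL hcptL => ih m hm L RdL hm0 hcptL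
      refine ⟨?_, ?_⟩
      · intro π hπ h2 ℓ _ ι
        by_cases h1 : (∃ T : Literature.NumberTheory.Automorphic.InfinityType F n, π.1.HasInfinityType T ∧ ∀ (σ : F →+* ℂ) (a : ℂ), ((T σ).map Literature.NumberTheory.Automorphic.ArchWeight.a).count a ≤ 1)
        · exact (hGb F Rd n hn hcpt hIH).1 π hπ h1 ℓ ι
        · exact (hA F).2 Rd n hn hcpt hIH π hπ ⟨h1, h2⟩ ℓ ι
      · intro ℓ _ ι ρ hirr hgeo h2
        by_cases h1 : (∀ (v : IsDedekindDomain.HeightOneSpectrum (NumberField.RingOfIntegers F)) (hv : ((ℓ : ℕ) : NumberField.RingOfIntegers F) ∈ v.asIdeal) (τ : v.adicCompletion F →+* PadicAlgCl ℓ), Continuous τ → ∀ w : ℤ, (ρ.labelledHodgeTateWeightsAt v (Literature.NumberTheory.PAdicHodge.fontainePstAdicCompletion v ℓ hv).algebra (Literature.NumberTheory.PAdicHodge.fontainePstAdicCompletion v ℓ hv).𝔅 τ).count w ≤ 1)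
        · exact (hGb F Rd n hn hcpt hIH).2 ℓ ι ρ hirr hgeo h1
        · by_cases hf : (∃ (L : Type) (_ : Field L) (_ : NumberField L) (_ : Algebra F L), ∀ σ : Field.absoluteGaloisGroup L, ∃ c : PadicAlgCl ℓ, ((ρ.restrictField L σ : GL (Fin n) (PadicAlgCl ℓ)) : Matrix (Fin n) (Fin n) (PadicAlgCl ℓ)) = c • (1 : Matrix (Fin n) (Fin n) (PadicAlgCl ℓ)))
          · exact hF F Rd n hn hcpt hIH ℓ ι ρ hirr hgeo ⟨⟨h1, h2⟩, hf⟩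
          · by_cases hl : (∀ (L : Type) [Field L] [NumberField L] [Algebra F L], (ρ.restrictField L).toGaloisRep.IsIrreducible)
            · exact hP F Rd n hn hcpt hIH ℓ ι ρ hirr hgeo ⟨⟨h1, h2⟩, hf, hl⟩
            · exact hS F Rd n hn hcpt hIH ℓ ι ρ hirr hgeo ⟨⟨h1, h2⟩, hf, hl⟩
  intro F _ _
  refine ⟨(hA F).1, fun Rd n hn hcpt => ⟨?_, ?_⟩⟩
  · intro π hπ hw ℓ _ ι
    exact (key n F Rd hn hcpt).1 π hπ hw.2 ℓ ι
  · intro ℓ _ ι ρ hirr hgeo hw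
    exact (key n F Rd hn hcpt).2 ℓ ι ρ hirr hgeo hw.2
end Summit.Langlands.Langlands.Theorems
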